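import Summits.Langlands.Langlands.Theorems.ParityBlindBianchiTwoAdicBianchiProModularityLevelSqueezeDefsLoci
import Summits.Langlands.Langlands.Theorems.ParityBlindBianchiTwoAdicBianchiProModularityLevelSqueezeTypeLocusReduced
import HarnessLib

/-!
# Route `ParityBlindBianchi`, crux `TwoAdicBianchiProModularityLevel` (stmt-Langlands-15110), line
# `dimension-squeeze`: structure of the locus `R ⧸ locusOf I` of an arbitrary ideal (v3)

Generic companions (GAL stub-worker of lead c14, wave 2) of the landed v2 file
`…SqueezeTypeLocusReduced.lean` (p138913), now for the loci `Model.pointsOf 𝓡 I`, `Model.locusOf 𝓡 I` of an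
ARBITRARY ideal `I` of the universal ring `R` (landed vocabulary `…SqueezeDefsLoci.lean`, p139601); the v3 Galois
stub `stub_galoisDomain` is the instance `I = typeIdealD`.  Nothing is assumed.

* `Model.mem_locusOf_iff` — `r ∈ locusOf I ↔ φ(r) = 0` for every point `φ` of `V(I)`;
* `Model.locusOf_le_ker` — `locusOf I ≤ ker φ` for every point `φ` of `V(I)`;
* `Model.pointsOf_locusOf`, `Model.locusOf_locusOf` — idempotence: `V(locusOf I)` has the same
  characteristic-`0` points as `V(I)`, and `locusOf` is a closure operator;
* `Model.locusOf_eq_top_iff` — `locusOf I = ⊤ ↔ pointsOf I = ∅`;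
* `Model.locusOf_quotient_injective` — the evaluation map `R ⧸ locusOf I → ∏_{φ ∈ pointsOf I} 𝒪_{ℚ̄₂}` is
  injective;
* `squeeze_locusOf_reduced_torsionFree` (REGISTERED SUB-GOAL) — `R ⧸ locusOf I` is reduced and `2`-torsion-free;
* `squeeze_locusOf_idempotent` (REGISTERED SUB-GOAL) — `pointsOf (locusOf I) = pointsOf I` and
  `locusOf (locusOf I) = locusOf I`;
* `squeeze_locusOf_eq_top_iff` (REGISTERED SUB-GOAL) — `locusOf I = ⊤ ↔ pointsOf I = ∅`;
* `squeeze_locusOf_quotient_embedding` (REGISTERED SUB-GOAL) — `R ⧸ locusOf I ↪ ∏_{φ ∈ pointsOf I} 𝒪_{ℚ̄₂}`;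
* `squeeze_locusOf_torsionFree` (REGISTERED SUB-GOAL) — non-zero elements of `𝒪` are non-zero-divisors on
  `R ⧸ locusOf I`.

References: M. Kisin, *Moduli of finite flat group schemes, and modularity*, Ann. of Math. 170 (2009), §2.3
(the reduced `𝒪`-flat quotients cut out by their `Ē`-points) [cite: KisinModuli2009, §2.3].
-/

noncomputable section

set_option linter.dupNamespace false -- `Summit.Langlands.Langlands` is the mandated namespace (D-0017)

open scoped NumberField MatrixGroups
open IsDedekindDomain Field
open Literature.NumberTheory.GaloisRepresentations

namespace Summit.Langlands.Langlands.Cruxes.TwoAdicBianchiProModularityLevel.DimensionSqueeze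

/-! ### The locus of an arbitrary ideal: membership, idempotence, emptiness -/

namespace Model

variable {K : Type} [Field K] [NumberField K] {σ : FramedGaloisRep K (PadicAlgCl 2) 2} (M : Model σ)
  {S₀ : Finset ℕ} {h0 : (0 : ℕ) ∉ S₀} {h2 : 2 ∈ S₀}
  {hunr : ∀ v ∉ badSet K S₀, Deformation.IsUnramifiedAt v M.residual}

/-- Membership in `locusOf I`: vanishing at every characteristic-`0` point of `V(I)`. [folklore] -/
theorem mem_locusOf_iff (𝓡 : PolarizedDeformationRing (M.datum S₀ h0 h2 hunr)) (I : Ideal 𝓡.R) (r : 𝓡.R) :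
    r ∈ M.locusOf 𝓡 I ↔ ∀ φ ∈ M.pointsOf 𝓡 I, φ r = 0 := by
  simp only [locusOf, Ideal.mem_iInf, RingHom.mem_ker]

/-- `locusOf I ≤ ker φ` for every point `φ` of `V(I)`. [folklore] -/
theorem locusOf_le_ker (𝓡 : PolarizedDeformationRing (M.datum S₀ h0 h2 hunr)) {I : Ideal 𝓡.R}
    {φ : 𝓡.R →+* O2} (hφ : φ ∈ M.pointsOf 𝓡 I) : M.locusOf 𝓡 I ≤ RingHom.ker φ :=
  iInf₂_le φ hφ

/-- **Idempotence, points**: `V(locusOf I)` has the same characteristic-`0` points as `V(I)`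
(`I ≤ locusOf I` gives `⊆`; a point of `V(I)` kills `locusOf I ≤ ker φ`). [folklore] -/
theorem pointsOf_locusOf (𝓡 : PolarizedDeformationRing (M.datum S₀ h0 h2 hunr)) (I : Ideal 𝓡.R) :
    M.pointsOf 𝓡 (M.locusOf 𝓡 I) = M.pointsOf 𝓡 I :=
  Set.Subset.antisymm (M.pointsOf_mono (M.le_locusOf 𝓡 I)) fun _ hφ => ⟨hφ.1, M.locusOf_le_ker 𝓡 hφ⟩

/-- **Idempotence, locus**: `locusOf` is a closure operator, `locusOf (locusOf I) = locusOf I`.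
[folklore] -/
theorem locusOf_locusOf (𝓡 : PolarizedDeformationRing (M.datum S₀ h0 h2 hunr)) (I : Ideal 𝓡.R) :
    M.locusOf 𝓡 (M.locusOf 𝓡 I) = M.locusOf 𝓡 I := by
  show ⨅ φ ∈ M.pointsOf 𝓡 (M.locusOf 𝓡 I), RingHom.ker φ = _
  rw [pointsOf_locusOf]
  rfl

/-- `locusOf I = ⊤` exactly when `V(I)` has no characteristic-`0` point. [folklore] -/
theorem locusOf_eq_top_iff (𝓡 : PolarizedDeformationRing (M.datum S₀ h0 h2 hunr)) (I : Ideal 𝓡.R) :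
    M.locusOf 𝓡 I = ⊤ ↔ M.pointsOf 𝓡 I = ∅ := by
  constructor
  · intro h
    refine Set.eq_empty_iff_forall_notMem.mpr fun φ hφ => ?_
    have hle : M.locusOf 𝓡 I ≤ RingHom.ker φ := M.locusOf_le_ker 𝓡 hφ
    rw [h, top_le_iff] at hle
    exact RingHom.ker_ne_top φ hle
  · intro h
    rw [locusOf, h]
    simp

/-- **`R ⧸ locusOf I` embeds in a product of copies of `𝒪_{ℚ̄₂}`**: the evaluation map
`R ⧸ locusOf I → ∏_{φ ∈ pointsOf I} 𝒪_{ℚ̄₂}` is an injective ring homomorphism (its kernel is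
`⨅ ker φ = locusOf I` by definition). [cite: KisinModuli2009, §2.3] -/
theorem locusOf_quotient_injective (𝓡 : PolarizedDeformationRing (M.datum S₀ h0 h2 hunr)) (I : Ideal 𝓡.R) :
    Function.Injective
      (Ideal.Quotient.lift (M.locusOf 𝓡 I)
        (RingHom.pi fun φ : M.pointsOf 𝓡 I => (φ : 𝓡.R →+* O2))
        (fun r hr => funext fun φ => (M.mem_locusOf_iff 𝓡 I r).mp hr φ φ.2)) := by
  rw [RingHom.injective_iff_ker_eq_bot, RingHom.ker_eq_bot_iff_eq_zero]
  intro x hx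
  obtain ⟨r, rfl⟩ := Ideal.Quotient.mk_surjective x
  rw [Ideal.Quotient.lift_mk] at hx
  rw [Ideal.Quotient.eq_zero_iff_mem, M.mem_locusOf_iff]
  intro φ hφ
  exact congrFun hx ⟨φ, hφ⟩

/-- `R ⧸ locusOf I` is reduced: `r ^ n ∈ ⨅ ker φ ⇒ φ(r) ^ n = 0 ⇒ φ(r) = 0` in the domain `𝒪_{ℚ̄₂}`.
[cite: KisinModuli2009, §2.3] -/
theorem locusOf_quotient_isReduced (𝓡 : PolarizedDeformationRing (M.datum S₀ h0 h2 hunr)) (I : Ideal 𝓡.R) :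
    IsReduced (𝓡.R ⧸ M.locusOf 𝓡 I) := by
  refine (Ideal.isRadical_iff_quotient_reduced _).mp fun r hr => ?_
  obtain ⟨n, hn⟩ := hr
  rw [M.mem_locusOf_iff] at hn ⊢
  intro φ hφ
  exact IsNilpotent.eq_zero ⟨n, by rw [← map_pow]; exact hn φ hφ⟩

/-- `R ⧸ locusOf I` has no `2`-torsion: `2 r ∈ ⨅ ker φ ⇒ 2 φ(r) = 0 ⇒ φ(r) = 0` as `2 ≠ 0` in
`𝒪_{ℚ̄₂}`. [cite: KisinModuli2009, §2.3] -/
theorem locusOf_quotient_two_torsionFree (𝓡 : PolarizedDeformationRing (M.datum S₀ h0 h2 hunr))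
    (I : Ideal 𝓡.R) (x : 𝓡.R ⧸ M.locusOf 𝓡 I) (hx : 2 * x = 0) : x = 0 := by
  obtain ⟨r, rfl⟩ := Ideal.Quotient.mk_surjective x
  have hr : Ideal.Quotient.mk (M.locusOf 𝓡 I) (2 * r) = 0 := by rw [map_mul, map_ofNat]; exact hx
  rw [Ideal.Quotient.eq_zero_iff_mem, M.mem_locusOf_iff] at hr ⊢
  intro φ hφ
  have h2r := hr φ hφ
  rw [map_mul, map_ofNat] at h2r
  exact (mul_eq_zero.mp h2r).resolve_left two_ne_zero_O2

/-- The `𝒪`-torsion-freeness in its natural form: a non-zero `a ∈ 𝒪` is a non-zero-divisor on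
`R ⧸ locusOf I` (`emb` is injective and `𝒪_{ℚ̄₂}` is a domain). [cite: KisinModuli2009, §2.3] -/
theorem locusOf_quotient_torsionFree (𝓡 : PolarizedDeformationRing (M.datum S₀ h0 h2 hunr))
    (I : Ideal 𝓡.R) {a : M.𝒪} (ha : a ≠ 0) (x : 𝓡.R ⧸ M.locusOf 𝓡 I)
    (hx : Ideal.Quotient.mk (M.locusOf 𝓡 I) (algebraMap M.𝒪 𝓡.R a) * x = 0) : x = 0 := by
  obtain ⟨r, rfl⟩ := Ideal.Quotient.mk_surjective x
  rw [← map_mul, Ideal.Quotient.eq_zero_iff_mem, M.mem_locusOf_iff] at hx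
  rw [Ideal.Quotient.eq_zero_iff_mem, M.mem_locusOf_iff]
  intro φ hφ
  have har := hx φ hφ
  rw [map_mul, ← RingHom.comp_apply, hφ.1] at har
  refine (mul_eq_zero.mp har).resolve_left fun h => ha (M.emb_injective ?_)
  rw [h, map_zero]

/-- The same, in the form AUT consumes: a non-zero `a ∈ 𝒪` maps to a non-zero-divisor of
`R ⧸ locusOf I`. [cite: KisinModuli2009, §2.3] -/
theorem locusOf_quotient_mem_nonZeroDivisors (𝓡 : PolarizedDeformationRing (M.datum S₀ h0 h2 hunr))
    (I : Ideal 𝓡.R) {a : M.𝒪} (ha : a ≠ 0) :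
    algebraMap M.𝒪 (𝓡.R ⧸ M.locusOf 𝓡 I) a ∈ nonZeroDivisors (𝓡.R ⧸ M.locusOf 𝓡 I) := by
  refine mem_nonZeroDivisors_iff_left.mpr fun x hx => ?_
  exact M.locusOf_quotient_torsionFree 𝓡 I ha x hx

end Model

/-! ### Registered sub-goals -/

/-- REGISTERED SUB-GOAL `squeeze_locusOf_reduced_torsionFree` (generic v3 form of the landed
`squeeze_typeLocus_reduced_torsionFree`): **for every ideal `I` of `R`, the locus `R ⧸ locusOf I` is
reduced and `2`-torsion-free** — it embeds in `∏_{φ ∈ pointsOf I} 𝒪_{ℚ̄₂}`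
(`Model.locusOf_quotient_injective`). [cite: KisinModuli2009, §2.3] -/
theorem squeeze_locusOf_reduced_torsionFree : ∀ (K : Type) [Field K] [NumberField K]
    (σ : FramedGaloisRep K (PadicAlgCl 2) 2) (M : Model σ) (S₀ : Finset ℕ) (h0 : (0 : ℕ) ∉ S₀) (h2 : 2 ∈ S₀)
    (hunr : ∀ v ∉ badSet K S₀, Deformation.IsUnramifiedAt v M.residual)
    (𝓡 : PolarizedDeformationRing (M.datum S₀ h0 h2 hunr)) (I : Ideal 𝓡.R),
    IsReduced (𝓡.R ⧸ M.locusOf 𝓡 I) ∧ ∀ x : 𝓡.R ⧸ M.locusOf 𝓡 I, 2 * x = 0 → x = 0 :=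
  fun _ _ _ _ M _ _ _ _ 𝓡 I => ⟨M.locusOf_quotient_isReduced 𝓡 I, M.locusOf_quotient_two_torsionFree 𝓡 I⟩

/-- REGISTERED SUB-GOAL `squeeze_locusOf_idempotent`: **`locusOf` is a closure operator with the same
characteristic-`0` points** — `pointsOf (locusOf I) = pointsOf I` and `locusOf (locusOf I) = locusOf I`
(so GAL / AUT / READ may be stated for `locusOf I` of any `I` between `typeIdealD` and its locus
without change). [folklore] -/
theorem squeeze_locusOf_idempotent : ∀ (K : Type) [Field K] [NumberField K]
    (σ : FramedGaloisRep K (PadicAlgCl 2) 2) (M : Model σ) (S₀ : Finset ℕ) (h0 : (0 : ℕ) ∉ S₀) (h2 : 2 ∈ S₀)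
    (hunr : ∀ v ∉ badSet K S₀, Deformation.IsUnramifiedAt v M.residual)
    (𝓡 : PolarizedDeformationRing (M.datum S₀ h0 h2 hunr)) (I : Ideal 𝓡.R),
    M.pointsOf 𝓡 (M.locusOf 𝓡 I) = M.pointsOf 𝓡 I ∧ M.locusOf 𝓡 (M.locusOf 𝓡 I) = M.locusOf 𝓡 I :=
  fun _ _ _ _ M _ _ _ _ 𝓡 I => ⟨M.pointsOf_locusOf 𝓡 I, M.locusOf_locusOf 𝓡 I⟩

/-- REGISTERED SUB-GOAL `squeeze_locusOf_eq_top_iff`: **the locus of `I` is empty (`R ⧸ locusOf I = 0`)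
exactly when `V(I)` has no characteristic-`0` point.** [folklore] -/
theorem squeeze_locusOf_eq_top_iff : ∀ (K : Type) [Field K] [NumberField K]
    (σ : FramedGaloisRep K (PadicAlgCl 2) 2) (M : Model σ) (S₀ : Finset ℕ) (h0 : (0 : ℕ) ∉ S₀) (h2 : 2 ∈ S₀)
    (hunr : ∀ v ∉ badSet K S₀, Deformation.IsUnramifiedAt v M.residual)
    (𝓡 : PolarizedDeformationRing (M.datum S₀ h0 h2 hunr)) (I : Ideal 𝓡.R),
    M.locusOf 𝓡 I = ⊤ ↔ M.pointsOf 𝓡 I = ∅ :=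
  fun _ _ _ _ M _ _ _ _ 𝓡 I => M.locusOf_eq_top_iff 𝓡 I

/-- REGISTERED SUB-GOAL `squeeze_locusOf_quotient_embedding`: **`R ⧸ locusOf I ↪ ∏_{φ ∈ pointsOf I} 𝒪_{ℚ̄₂}`**
— there is an injective ring homomorphism to the product evaluating `r` at each point
(`Model.locusOf_quotient_injective`). [cite: KisinModuli2009, §2.3] -/
theorem squeeze_locusOf_quotient_embedding : ∀ (K : Type) [Field K] [NumberField K]
    (σ : FramedGaloisRep K (PadicAlgCl 2) 2) (M : Model σ) (S₀ : Finset ℕ) (h0 : (0 : ℕ) ∉ S₀) (h2 : 2 ∈ S₀)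
    (hunr : ∀ v ∉ badSet K S₀, Deformation.IsUnramifiedAt v M.residual)
    (𝓡 : PolarizedDeformationRing (M.datum S₀ h0 h2 hunr)) (I : Ideal 𝓡.R),
    ∃ e : (𝓡.R ⧸ M.locusOf 𝓡 I) →+* (M.pointsOf 𝓡 I → O2), Function.Injective e ∧
      ∀ (r : 𝓡.R) (φ : M.pointsOf 𝓡 I), e (Ideal.Quotient.mk (M.locusOf 𝓡 I) r) φ = (φ : 𝓡.R →+* O2) r :=
  fun _ _ _ _ M _ _ _ _ 𝓡 I => ⟨_, M.locusOf_quotient_injective 𝓡 I, fun _ _ => rfl⟩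

/-- REGISTERED SUB-GOAL `squeeze_locusOf_torsionFree`: **`R ⧸ locusOf I` is `𝒪`-torsion-free** — every
non-zero `a ∈ 𝒪` is a non-zero-divisor on it (the hypothesis shape of `squeeze_heckeDimensionOf_of_heckeAlgebra`).
[cite: KisinModuli2009, §2.3] -/
theorem squeeze_locusOf_torsionFree : ∀ (K : Type) [Field K] [NumberField K]
    (σ : FramedGaloisRep K (PadicAlgCl 2) 2) (M : Model σ) (S₀ : Finset ℕ) (h0 : (0 : ℕ) ∉ S₀) (h2 : 2 ∈ S₀)
    (hunr : ∀ v ∉ badSet K S₀, Deformation.IsUnramifiedAt v M.residual)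
    (𝓡 : PolarizedDeformationRing (M.datum S₀ h0 h2 hunr)) (I : Ideal 𝓡.R) (a : M.𝒪), a ≠ 0 →
    algebraMap M.𝒪 (𝓡.R ⧸ M.locusOf 𝓡 I) a ∈ nonZeroDivisors (𝓡.R ⧸ M.locusOf 𝓡 I) :=
  fun _ _ _ _ M _ _ _ _ 𝓡 I _ ha => M.locusOf_quotient_mem_nonZeroDivisors 𝓡 I ha

end Summit.Langlands.Langlands.Cruxes.TwoAdicBianchiProModularityLevel.DimensionSqueeze

end
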